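import Summits.CriticalPhenomena.PercolationContinuityZ3.Theorems.Transplant.SkelPhiKitsAHab
import Summits.CriticalPhenomena.PercolationContinuityZ3.Theorems.Transplant.SkelPhiKitsAStepIV
import HarnessLib

/-!
# N1 (the `{±1}` node), LEVEL 1, kit adapter file N-K7b: **THE APRON KIT CLAUSE OVER A HABITAT WINDOW WITH STEP IV** (`Skelφ.kitClauseAHab'`)
# — `kitClauseAHab` with the near contacts' Step IV discharged by `KNLevels.stepIV_out` over `winGraphIn G Ω` from the three `G`-level inputs at
# the kit centre (zone, exit link below the shell line inside the short region, route datum), exactly as `kitClauseA'` over `winGraph G w₀ R`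

builds on p205010 (kernel theorem, internal audit signed; external expert review pending) — nothing in this file uses p205010; nothing here is a
claim about the open node `SamePDropOfSkeletonNeg`.
Lane `prim-bschramm`, seat `prim-bschramm-p1` (gen 11; design KIT-APRON-N1); helper file (`--supports stmt-CriticalPhenomena-4575 --as helper`).
* **`kitClauseAHab'`**.
[cite: KozmaNitzan2024, §4 Lemma 10, Steps III–IV (pp. 19–21)] [cite: GrimmettPercolation1999, §7.2]
-/

noncomputable section

open scoped Classical

namespace Summit.CriticalPhenomena.PercolationContinuityZ3.Theorems.Transplant

namespace Skelφ

open MeasureTheory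
open Literature.Probability.Percolation Literature.Probability.LatticeModels SimpleGraph KNLevels
open Literature.Barriers.CriticalPhenomena (graphBall graphBall_finite mem_graphBall_self graphBall_mono)
open Skel (winGraph winGraph_adj winGraph_le winGraphIn winGraphIn_le KitGeom)
open SkelI (tanOff tanTgt tanTgt_mem)
open Literature.Probability.Percolation.KozmaNitzan.Cells (oth oth_ne eq_oth_of_ne oth_oth)

variable {V : Type} [DecidableEq V] {G : SimpleGraph V} [G.LocallyFinite] {ψ φ : V → Site 2}

/-- **THE KIT CLAUSE OF THE APRON KIT OVER A HABITAT WINDOW, NEAR CONTACTS' STEP IV FROM THE INPUTS AT THE KIT CENTRE** (the N1 twin of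
`kitClauseHab'`): as `kitClauseAHab`, with `hnear` replaced by, per near plain contact, a face vertex in the target or the three inputs (h1) zone,
(h2) exit link, (h3) route datum (under the subbox weighting of `winGraphIn G Ω`).
[cite: KozmaNitzan2024, §4 Lemma 10, Steps III–IV (pp. 19–21)] -/
theorem kitClauseAHab' [Countable V] {types : Finset V} {lo hi : Site 2} {j : ℕ} {w₀ : V} {R : ℕ}
    (SF : ∀ (i : Fin 2) (σ : ℤˣ), SideForm ψ φ (lo - (j : Site 2)) (hi + (j : Site 2)) i σ) (Rg : V → Finset V) {P : ApronPrm}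
    {Kmax KCmax Rs rs cS cU Δ nz kz n : ℕ}
    (hlip : Lip G ψ) (hq : QStepsN G ψ P.N) (hlipφ : Lip G φ) (hstep : Steps G φ) (hfr : Frames G φ types) (hκ : CylConn G φ types)
    (hΔ : ∀ v, G.degree v ≤ Δ) {q : unitInterval} {δ : ℝ} (hδ : 0 < δ) (hℓ : 1 ≤ P.ℓ)
    -- the window level and the kit constants
    (hwide : ∀ i, (lo - (j : Site 2)) i + 2 * tanOff P.ℓs P.M ≤ (hi + (j : Site 2)) i)
    (hdw : ∀ i, (lo - (j : Site 2)) i + (P.d + 2 : ℕ) ≤ (hi + (j : Site 2)) i) (hdD : P.d + 2 ≤ shellD P)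
    (hDw : ∀ i, (lo - (j : Site 2)) i + ((shellD P + 1 + P.d + KCmax + Rs : ℕ) : ℤ) ≤ (hi + (j : Site 2)) i) (hDρ : Rs + 1 ≤ shellD P)
    (hbelow : ∀ (i : Fin 2) (σ : ℤˣ) (z : Site 2), (SF i σ).lin z < (SF i σ).θ (2 + P.d) → ∀ m : ℤ, -(P.W : ℤ) ≤ m → m ≤ P.W →
      (SF i σ).lin (apronPt z (SF i σ).a (SF i σ).s m 0) + P.ℓ * (SF i σ).UL < (SF i σ).θ (shellD P))
    (habove : ∀ (i : Fin 2) (σ : ℤˣ) (z : Site 2), (SF i σ).θ (1 + P.d) ≤ (SF i σ).lin z → ∀ m : ℤ, -(P.W : ℤ) ≤ m → m ≤ P.W →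
      (SF i σ).θ 1 ≤ (SF i σ).lin (apronPt z (SF i σ).a (SF i σ).s m 0) - P.ℓ * (SF i σ).UL)
    (hK : ∀ (i : Fin 2) (σ : ℤˣ) (z : Site 2), (SF i σ).θ (1 + P.d) ≤ (SF i σ).lin z → ∀ m : ℤ, -(P.W : ℤ) ≤ m → m ≤ P.W →
      (SF i σ).apronK z (shellD P) P.ℓ m ≤ Kmax)
    (hKC : ∀ (i : Fin 2) (σ : ℤˣ) (z : Site 2), (SF i σ).θ (1 + P.d) ≤ (SF i σ).lin z → (SF i σ).lin z < (SF i σ).θ (2 + P.d) →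
      (SF i σ).kitK z (shellD P) P.A ≤ KCmax)
    (hθA : ∀ (i : Fin 2) (σ : ℤˣ), (SF i σ).θ (2 + P.d) ≤ (SF i σ).θ (shellD P) + P.A)
    (hAz : ∀ (i : Fin 2) (σ : ℤˣ), ((nz + 1 : ℕ) : ℤ) * (SF i σ).UL + 1 ≤ P.A)
    (hcap : ∀ (i : Fin 2) (σ : ℤˣ) (z : Site 2), (SF i σ).lin z < (SF i σ).θ (2 + P.d) →
      (P.ℓ : ℤ) * ((SF i σ).s * coef (SF i σ).cα (SF i σ).cβ (SF i σ).a) + (Rs : ℤ) * |coef (SF i σ).cα (SF i σ).cβ (oth (SF i σ).a)| +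
        (SF i σ).UL ≤ (SF i σ).θ (shellD P) - (SF i σ).lin z)
    (hcomp : ∀ (v w : V) (n : ℕ), φ v - φ w ∈ box 2 n → ∀ i, |ψ v i - ψ w i| ≤ n + 1)
    (hT : (P.W : ℤ) + Kmax + P.ℓ + 1 ≤ tanOff P.ℓs P.M) (hT' : (shellD P : ℤ) + KCmax + Rs ≤ tanOff P.ℓs P.M)
    (hW : Rs + P.ℓ ≤ P.W) (hR' : cylRadMax G φ types P.ℓ (Rs + KCmax + (P.W + Kmax)) ≤ P.R')
    (hRg : ∀ c, ∀ u ∈ Rg c, u ∈ graphBall G c Rs) (hRgcard : ∀ c, (Rg c).card ≤ cU) (hcU1 : 1 ≤ cU)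
    (hr₀ : P.N * (tanOff P.ℓs P.M + 2) + P.N * P.d + (P.W + Kmax + P.R') + (KCmax + Rs) ≤ P.r₀) (hr₀2 : 2 ≤ KCmax + Rs) (hR : P.r₀ ≤ R)
    (hrs : 2 * (1 + P.N * (tanOff P.ℓs P.M + 2) + P.N * P.d + (P.W + Kmax + P.R') + (KCmax + Rs)) ≤ rs)
    (hcS : (P.N + 1) * (tanOff P.ℓs P.M + 1) + (P.N + 1) * P.d + (2 * P.W + 1) * (Kmax + 1) * (Δ + 1) ^ P.R' ≤ cS)
    -- the zone family and the exit pieces, relative to a centre `c`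
    (Λc : V → ℕ → Finset V) (hkn : ∀ c, Λc c kz ⊆ Λc c n) (hΛ : ∀ c, ∀ v ∈ Λc c n, v ∈ Rg c ∧ φ v - φ c ∈ box 2 nz)
    (Pex : Fin 2 → ℤˣ → V → Finset V)
    (hPex : ∀ (i : Fin 2) (σ : ℤˣ) (c : V), ∀ v ∈ Pex i σ c, v ∈ Rg c ∧
      (SF i σ).lin (φ v) + P.A + (SF i σ).s * coef (SF i σ).cα (SF i σ).cβ (SF i σ).a ≤ (SF i σ).lin (φ c))
    -- the habitat, the level's source/support, the weighting, the region (a subbox containing the habitat level) and the target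
    {Ω : Finset V} (hfull : winLevel G ψ w₀ R lo hi j ⊆ Ω)
    (k : ℕ) (o : V) (Sfin : Finset V) {Wt : Sym2 V → unitInterval} {D T : Finset V} (hWD : IsSubbox (winGraphIn G Ω) Wt q D)
    (hXD : winLevelIn ψ Ω lo hi j ⊆ D) {N : ℕ} (hN : k * (Δ + 1) ^ (2 * rs) ≤ N)
    (hk : (1 - (q : ℝ) ^ (1 + Δ * cS + cS * cU)) ^ k ≤ δ)
    -- per contact: PADDED / FAR — the inner neighbour in the target; NEAR — a face vertex in the target, or the three Step-IV inputs
    (hpad : ∀ x ∈ outerBoundary (winGraphIn G Ω) (winLevelIn ψ Ω lo hi j), x ∉ outerBoundary (winGraph G w₀ R) (winLevel G ψ w₀ R lo hi j) →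
      inNbrIn G ψ Ω (Finset.Icc (lo - (j : Site 2)) (hi + (j : Site 2))) x ∈ T)
    (hfar : ∀ x ∈ outerBoundary (winGraph G w₀ R) (winLevel G ψ w₀ R lo hi j), ¬ IsNear G ψ (lo - (j : Site 2)) (hi + (j : Site 2)) P w₀ R x →
      ctY G ψ w₀ R (lo - (j : Site 2)) (hi + (j : Site 2)) x ∈ T)
    (hnear' : ∀ x ∈ outerBoundary (winGraph G w₀ R) (winLevel G ψ w₀ R lo hi j), IsNear G ψ (lo - (j : Site 2)) (hi + (j : Site 2)) P w₀ R x →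
      (∃ u ∈ ctFace G SF Rg P w₀ R x, u ∈ T) ∨
      (1 - δ ^ 2 < (bondPercolation G q).real (UniqZone.zone G (Λc (ctCtr G SF P w₀ R x)) kz n) ∧
        1 - δ ^ 2 < (bondPercolation G q).real (linkIn (↑(Rg (ctCtr G SF P w₀ R x)) : Set V) (Λc (ctCtr G SF P w₀ R x) kz)
          (Pex (ctDir G ψ w₀ R (lo - (j : Site 2)) (hi + (j : Site 2)) x).1 (ctDir G ψ w₀ R (lo - (j : Site 2)) (hi + (j : Site 2)) x).2
            (ctCtr G SF P w₀ R x))) ∧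
        ∃ Qt Ft : Finset V, Ft ⊆ T ∧ Qt ⊆ D ∧ Disjoint Ft (Λc (ctCtr G SF P w₀ R x) n) ∧
          1 - δ ^ 2 < (prodBernoulli Wt).real (linkIn (↑Qt : Set V) (Λc (ctCtr G SF P w₀ R x) kz) Ft))) :
    ∃ (σ : SData V) (S : Finset V), SHyp (winLDataIn G ψ Ω lo hi o Sfin) j σ ∧ σ.N ≤ N ∧
      (1 - (q : ℝ) ^ σ.sB) ^ σ.k ≤ δ ∧ S ⊆ (winLDataIn G ψ Ω lo hi o Sfin).X j ∧ S ⊆ D ∧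
      (∀ x ∈ σ.K, ∀ e ∈ σ.seed x, e ∉ wireSet (↑S : Set V)) ∧ (∀ x ∈ σ.K, σ.face x ⊆ S) ∧
      (∀ x ∈ σ.K, 1 - 3 * δ ≤ (prodBernoulli Wt).real {ω | ∃ u ∈ σ.face x,
        1 - δ < (prodBernoulli (pinW Wt (wireSet (↑S : Set V)) ω)).real (⋃ t ∈ T, openConnIn (↑D : Set V) u t)}) := by
  have hKeq : winLevel G ψ w₀ R lo hi j = Win G ψ w₀ (Finset.Icc (lo - (j : Site 2)) (hi + (j : Site 2))) R := rfl
  have hw2 : ∀ i, (lo - (j : Site 2)) i + 2 ≤ (hi + (j : Site 2)) i := fun i => by have := hwide i; unfold tanOff at this; omega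
  have hA : 0 ≤ P.A := le_trans (by positivity) (hAz 0 1)
  have hr₀' : P.N * (tanOff P.ℓs P.M + 1) + P.N * P.d + (KCmax + Rs) ≤ P.r₀ := by
    have : P.N * (tanOff P.ℓs P.M + 1) ≤ P.N * (tanOff P.ℓs P.M + 2) := Nat.mul_le_mul_left _ (by omega)
    omega
  have hr₀'' : P.N * (tanOff P.ℓs P.M + 2) + P.N * P.d + (P.W + Kmax + P.R') ≤ P.r₀ := by omega
  have hr₀3 : P.N * (tanOff P.ℓs P.M + 2) + P.N * P.d + (P.W + Kmax + P.R') + 2 ≤ P.r₀ := by omega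
  refine kitClauseAHab SF Rg hlip hq hstep hΔ hδ hwide hdw hdD hbelow habove hK hKC hcomp hT hRg hRgcard hcU1 hr₀3 hR hrs hcS hfull k o Sfin hXD
    hN hk hpad hfar fun x hx hnx => ?_
  have hx' : x ∈ outerBoundary (winGraph G w₀ R) (Win G ψ w₀ (Finset.Icc (lo - (j : Site 2)) (hi + (j : Site 2))) R) := by rwa [hKeq] at hx
  rcases hnear' x hx hnx with h | ⟨hz, hl, Qt, Ft, hFT, hQD, hdisj, h3⟩
  · exact Or.inl h
  refine Or.inr ?_
  set c := ctCtr G SF P w₀ R x with hc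
  set i₀ := (ctDir G ψ w₀ R (lo - (j : Site 2)) (hi + (j : Site 2)) x).1 with hi₀
  set σ₀ := (ctDir G ψ w₀ R (lo - (j : Site 2)) (hi + (j : Site 2)) x).2 with hσ₀
  set Qk := ctQk G SF Rg P w₀ R x with hQk
  set K := outerBoundary (winGraph G w₀ R) (winLevel G ψ w₀ R lo hi j) with hKdef
  -- ROOM: the short region lies in the window level (hence in `Ω` and in `D`), its shell part in the pinning set
  have hRgW : Rg c ⊆ winLevel G ψ w₀ R lo hi j := fun v hv =>
    ball_ctCtr_subset_winLevel SF hlip hq hstep hwide hKC hA hθA hr₀' hR hT' hDw hDρ hx hnx v (hRg c v hv)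
  have hRgΩ : Rg c ⊆ Ω := hRgW.trans hfull
  have hRgD : Rg c ⊆ D := (hRgW.trans (winLevel_subset_winLevelIn hfull)).trans hXD
  have hQkRg : Qk ⊆ Rg c := ctQk_subset_Rg SF Rg x
  have hQkD : Qk ⊆ D := hQkRg.trans hRgD
  have hQkS : Qk ⊆ pinSetAHab G SF P Ω w₀ R lo hi j := fun v hv => by
    unfold pinSetAHab
    exact Finset.mem_union_left _ ((ctQk_subset_shellWinA SF Rg (P := P) x |>.trans (shellWinA_subset_pinSetA G SF P w₀ R K)) hv)
  have hΛQk : Λc c n ⊆ Qk :=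
    zone_subset_ctQk SF Rg hlip hq hstep hwide hKC hA hθA (fun i σ => by
        have h := hAz i σ; have h0 : (0 : ℤ) ≤ ((SF i σ).UL : ℤ) := by positivity
        push_cast at h; nlinarith)
      hr₀' hR hT' hDw hx' hnx (fun v hv => (hΛ c v hv).1) (fun v hv => hRg c v (hΛ c v hv).1) (fun v hv => (hΛ c v hv).2)
  have hUfar : Disjoint (ctFace G SF Rg P w₀ R x) (Λc c n) :=
    disjoint_ctFace_zone SF Rg hlip hq hlipφ hstep hw2 hθA hAz hbelow habove hx' (fun v hv => (hΛ c v hv).2)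
  -- (h1) the zone, transferred to the subbox weighting of the window graph
  have h1 : 1 - δ ^ 2 < (prodBernoulli Wt).real (UniqZone.zone (winGraphIn G Ω) (Λc c) kz n) := by
    have heq := Skel.real_eq_of_isSubbox_of_le (winGraphIn_le G Ω) hWD (hΛQk.trans hQkD)
      (Skel.adj_winGraphIn_of_subset ((hΛQk.trans hQkRg).trans hRgΩ))
      (determinedBy_zone (G := G) (Λc c) kz n le_rfl) (measurableSet_zone (G := G) (Λc c) kz n)
    refine hz.trans_le ?_
    rw [← heq]
    exact measureReal_mono (zone_anti_graph (winGraphIn_le G Ω) (Λc c) kz n) (measure_ne_top _ _)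
  -- (h2) the exit link: transfer, then the first-exit inclusion with the capture lemma
  have h2 : 1 - δ ^ 2 < (prodBernoulli Wt).real (linkIn (↑Qk : Set V) (Λc c kz) (ctFace G SF Rg P w₀ R x)) := by
    set A := linkIn (↑(Rg c) : Set V) (Λc c kz) (Pex i₀ σ₀ c) with hAdef
    have heq := Skel.real_eq_of_isSubbox_of_le (winGraphIn_le G Ω) hWD hRgD (Skel.adj_winGraphIn_of_subset hRgΩ)
      (determinedBy_linkIn (↑(Rg c) : Set V) (Λc c kz) (Pex i₀ σ₀ c) subset_rfl) (measurableSet_linkIn (Rg c) (Λc c kz) (Pex i₀ σ₀ c))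
    have hA1 : 1 - δ ^ 2 < (prodBernoulli Wt).real A := by rw [hAdef, heq]; exact hl
    -- the inclusion `A ∩ lattOnly ⊆ linkIn Qk …`
    have hsub : A ∩ lattOnly (winGraphIn G Ω) D ⊆ linkIn (↑Qk : Set V) (Λc c kz) (ctFace G SF Rg P w₀ R x) := by
      refine linkIn_exit_subset SF Rg (winGraphIn_le G Ω) hRgD ?_ ?_ ?_
      · exact fun v hv => ctQk_subset_shellWinA SF Rg (P := P) x (hΛQk (hkn c hv))
      · intro t ht htS
        obtain ⟨htR, htL⟩ := hPex i₀ σ₀ c t ht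
        have hDt := (mem_shellWinA_iff_of_ball_ctCtr SF hlip hq hstep hwide hKC hA hθA hr₀' hR hT' hDw hx' hnx (hRg c t htR)).1 htS
        -- but `L(φ t) ≤ L(φ c) − A − C < θ D`
        have ht₁ := ψ_ctT1 hlip hq hw2 hx'
        have hzlt := (SF i₀ σ₀).lin_lt_of_sdepth_lt (φ := φ) (v := ctT1 G ψ P w₀ R (lo - (j : Site 2)) (hi + (j : Site 2)) x)
          (m := 2 + P.d) (by rw [hi₀, hσ₀, ht₁.1]; omega)
        have hcl : (SF i₀ σ₀).lin (φ c) < (SF i₀ σ₀).θ (shellD P) + P.A + (SF i₀ σ₀).s * coef (SF i₀ σ₀).cα (SF i₀ σ₀).cβ (SF i₀ σ₀).a := by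
          rw [hc, φ_ctCtr SF hstep]; exact (SF i₀ σ₀).lin_kitPt_lt (by have := hθA i₀ σ₀; linarith)
        have hge := (SF i₀ σ₀).le_lin_of_le_sdepth hDt
        linarith
      · intro u w huR huS hwR hwS hadj
        exact mem_ctApron_of_exit SF hlip hq hlipφ hstep hfr hκ hℓ hwide hK hKC hA hθA hcap hW hR' hr₀' hR hT' hDw hx' hnx huS (hRg c w hwR) hwS hadj
    have hL : (prodBernoulli Wt).real (lattOnly (winGraphIn G Ω) D)ᶜ = 0 := hWD.real_compl_lattOnly
    have hcov : A ⊆ (A ∩ lattOnly (winGraphIn G Ω) D) ∪ (lattOnly (winGraphIn G Ω) D)ᶜ := by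
      intro ω hω; by_cases h : ω ∈ lattOnly (winGraphIn G Ω) D
      · exact Or.inl ⟨hω, h⟩
      · exact Or.inr h
    have hle := (measureReal_mono hcov (measure_ne_top _ _)).trans
      ((measureReal_union_le _ _).trans (add_le_add (measureReal_mono hsub (measure_ne_top _ _)) (le_of_eq hL)))
    rw [add_zero] at hle
    exact hA1.trans_le hle
  exact KNLevels.stepIV_out (G := winGraphIn G Ω) hWD hFT hQD (Λc c) (hkn c) hQkD hQkS hΛQk hUfar hdisj hδ (Rg := (↑D : Set V))
    (Finset.coe_subset.2 hQkD) (Finset.coe_subset.2 hQD) h1 h2 h3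


end Skelφ

end Summit.CriticalPhenomena.PercolationContinuityZ3.Theorems.Transplant

end
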